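import Summits.BirchSwinnertonDyer.BirchSwinnertonDyer.Theorems.PrintCFramBottomClassIndexLawFiveLeAnchorSmallConductor
import Summits.BirchSwinnertonDyer.BirchSwinnertonDyer.Theorems.PrintCFramBottomClassIndexLawFiveLeAnchorUnitStratum
import Summits.BirchSwinnertonDyer.BirchSwinnertonDyer.Theorems.PrintCFramBottomClassIndexLawFiveLeAnchorBernoulli163
import Literature.NumberTheory.EllipticCurves.BuhlerGross1985.PiDescent
import Literature.NumberTheory.EllipticCurves.HeegnerPointsKolyvaginExceptionalProofs
import Literature.NumberTheory.EllipticCurves.KrizLi2019.TeichmullerCharacterExists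
import HarnessLib

/-!
# Crux `PrintCFram.BottomClassIndexLawFiveLe` (stmt-BirchSwinnertonDyer-20372), line `relative-anchor-transfer`
# (sha16 72dde5b866033574), stub `stub_unitAnchor`: the LAST class `(163, j(A(163)))` — the anchor `A(163)`
# modulo Buhler–Gross 1985 Ch. II BY NAME (`firstDescent_grossCurve_threeModEight_of_bernoulli`, p608979, its
# Bernoulli hypothesis DISCHARGED by the kernel certificate `‖B_{1,ω^{121}}‖_{163} = 1` of `…AnchorBernoulli163`),
# GZK, Cassels, entire continuation, and TWO displayed data: `r_an(A(163)) = 1` and `ord_{163} #Ш_an(A(163)) = 0`;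
# then the WHOLE STUB modulo six named facts + the displayed per-curve data + the two `p = 7` anchors
# (cell `bsd-print-cfram`, width seat `bsd-line-cfram-p1-w2`; THEOREMS ONLY, `--supports` 20372; nothing
# certified about `#Ш_an`; BSD is not proved by any of this)

HONEST FRAMING. Sixth file of the anchor side. For `A(163) = cm163 = 26569a1` (`N = 163² > 5000`, the only
class of the `@≥5` leaf outside the printed `N < 5000` theorem):
* §1 `natCard_selmerGroup_eq_of_rank_one` — for an elliptic curve over a number field, `rank = 1`,
  `Ш[p] = 0` and `E(F)[p] = 0` give `#Sel^{(p)} = p` (the Kummer sequence (2.2): `exists_kummerMap_holds`,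
  `map_torsionH1ToH1_selmerGroup_holds`, `natCard_quotient_range_zsmul_eq` — the argument of the tree's
  `exists_forall_prime_card_selmerGroup_eq`, isolated at ONE prime).
* §2 `anchor_onesixtythree_of_buhlerGross` — Buhler–Gross Ch. II on `A(163)` BY NAME (rank `≤ 1`, no
  `163`-torsion, rank `≥ 1 ⇒ Ш[163] = 0`; its hypothesis `B_{1,ω^{121}} ≢ 0 (mod 163)` is the kernel theorem
  `not_norm_bernoulliOnePrim_pow_121_le_p163`, a Teichmüller `ω` exists by `exists_isTeichmullerCharacter`)
  + GZK with the binder `r_an(cm163) = 1` (rank `= 1`) ⟹ `#Sel^{163}(A(163)) = 163` (§1) ⟹ with the binder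
  `#Ш_an(cm163) = q`, `ord_{163} q = 0`: `S_open(A(163), 163)` by `rubinFormulaAtZp_of_unit_member`
  (sibling `X12.bsdp_of_classX12_of_card_selmerGroup_dvd` + cell `bsd-cm`'s `ramifiedCMRubinFormulaAtZp_of_bsdp`).
* §3 `stub_unitAnchor_of_print_of_data` — the registered stub VERBATIM from: the six named facts
  {`bsdp_of_irreducible_of_conductor_lt`, `bsdp_of_reducible_of_conductor_lt` (the `N < 5000` theorem),
  Cassels, entire continuation, GZK, Buhler–Gross 1985 on `A(p)`}; the analytic binders `r_an(cmP) = 1`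
  (`P = 11, 19, 43, 67, 163`); ONE analytic datum `ord_{163} #Ш_an(cm163) = 0` (NOT certified — the place of
  Kriz–Li Thm. 1.20 at `p = 163` with `K″ = ℚ(√−7)` and cell `bsd-cm`'s Route U glue; its second Bernoulli
  number `β₂` is not certified here); and the two displayed `p = 7` anchors (`…AnchorSeven`: Route U's member
  at Route U's price). That is the complete, kernel-checked price list of `stub_unitAnchor`.
beyond-print theorem: NO.

References: [BuhlerGross1985] Ch. II; [GrossLMS1991] §2 (2.2); [Miller2011LMS] Def. 1.1; [CreutzMiller2012] Thm. 1.1;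
[MillerStoll2012] Thm. 9.1; [Cassels1965ArithmeticVIII]; [Washington1997] §5.1; [KrizLi2019] Thm. 1.20 (context).
-/

noncomputable section

-- summit-side namespace `Summit.BirchSwinnertonDyer.BirchSwinnertonDyer.…` (single-conjunct summit, D-0017 layout)
set_option linter.dupNamespace false

open scoped Classical

open WeierstrassCurve DirichletCharacter
  Literature.NumberTheory.EllipticCurves Literature.NumberTheory.EllipticCurves.Rank1Residual
  Literature.NumberTheory.EllipticCurves.KrizLi2019
  Summit.BirchSwinnertonDyer.Rank1Residual
  Summit.BirchSwinnertonDyer.Rank1Residual.X12.O11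
  Summit.BirchSwinnertonDyer.BirchSwinnertonDyer.Theorems.RamifiedSevenEllipticUnits

namespace Summit.BirchSwinnertonDyer.BirchSwinnertonDyer.Theorems.PrintCFram.AnchorReduction

universe u

/-! ## §1 `#Sel^{(p)}(E/F) = p` from rank one, `Ш[p] = 0`, `E(F)[p] = 0` -/

/-- **`rank E(F) = 1`, `Ш(E/F)[p] = 0`, `E(F)[p] = 0` ⟹ `#Sel^{(p)}(E/F) = p`** for an elliptic curve over a
number field: by (2.2) `Sel^{(p)}` dies in `H¹(F, E)` (`map_torsionH1ToH1_selmerGroup_holds`), hence equals the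
Kummer image `δ(E(F)) ≅ E(F)/pE(F)` (`exists_kummerMap_holds`), of order `p^{rank} = p`
(`natCard_quotient_range_zsmul_eq`). The one-prime core of the tree's
`exists_forall_prime_card_selmerGroup_eq`. [cite: GrossLMS1991, §2 ((2.2) and the sentence after it)] -/
theorem natCard_selmerGroup_eq_of_rank_one {F : Type u} [Field F] [NumberField F] (V : WeierstrassCurve F)
    [V.IsElliptic] {p : ℕ} (hp : p.Prime) (hr : V.mordellWeilRank = 1)
    (hsha0 : ∀ c : V.sha, p • c = 0 → c = 0)
    (htors : AddSubgroup.torsionBy V.toAffine.Point (p : ℤ) = ⊥) : Nat.card (V.selmerGroup p) = p := by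
  haveI : Module.Finite ℤ V.toAffine.Point := V.module_finite_point_holds
  have hp0 : ((p : ℕ) : ℤ) ≠ 0 := by exact_mod_cast hp.ne_zero
  obtain ⟨κ, hker, hrange⟩ := V.exists_kummerMap_holds (n := (p : ℤ)) hp0
  have hmap := V.map_torsionH1ToH1_selmerGroup_holds (n := (p : ℤ)) hp0
  -- `Sel^(p)` dies in `H¹(F, E)` since `Ш[p] = 0`
  have hSelker : V.selmerGroup p ≤ (V.torsionH1ToH1 p).ker := by
    intro s hs
    have hmem : V.torsionH1ToH1 p s ∈ V.sha ⊓ AddSubgroup.torsionBy V.galH1 (p : ℤ) :=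
      hmap ▸ AddSubgroup.mem_map_of_mem _ hs
    obtain ⟨h1, h2⟩ := hmem
    have h0 := hsha0 ⟨_, h1⟩ (Subtype.ext (by
      rw [AddSubgroupClass.coe_nsmul, ZeroMemClass.coe_zero]
      exact AddSubgroup.torsionBy.nsmul_iff.mp h2))
    rw [AddMonoidHom.mem_ker]
    exact congrArg Subtype.val h0
  have hRS : κ.range = V.selmerGroup p := by
    rw [hrange]
    exact inf_eq_left.mpr hSelker
  have hcardR : Nat.card κ.range =
      Nat.card (V.toAffine.Point ⧸ (zsmulAddGroupHom (α := V.toAffine.Point) (p : ℤ)).range) := by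
    rw [← hker]
    exact (Nat.card_congr (QuotientAddGroup.quotientKerEquivRange κ).toEquiv).symm
  have hr' : Module.finrank ℤ V.toAffine.Point = 1 := hr
  rw [← hRS, hcardR,
    Literature.NumberTheory.EllipticCurves.natCard_quotient_range_zsmul_eq hp htors, hr', pow_one]

/-- Transport of "no `p`-torsion" between two (propositionally equal) additive group structures on one
type — bookkeeping for the two `DecidableEq ℚ` instances (`instDecidableEqRat` in the named fact, the classical
one in lemmas stated over a general number field) behind `Affine.Point.instAddCommGroup`. [folklore] -/
theorem torsionBy_eq_bot_of_forall_nsmul {A : Type u} (I₁ I₂ : AddCommGroup A) (hI : I₁ = I₂) (p : ℕ)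
    (h : letI : AddCommGroup A := I₁; ∀ x : A, p • x = 0 → x = 0) :
    letI : AddCommGroup A := I₂; AddSubgroup.torsionBy A (p : ℤ) = ⊥ := by
  subst hI
  rw [eq_bot_iff]
  intro x hx
  exact (AddSubgroup.mem_bot).mpr (h x (AddSubgroup.torsionBy.nsmul_iff.mp hx))

/-! ## §2 The `(163, j(A(163)))` anchor from Buhler–Gross BY NAME + the kernel Bernoulli certificate -/

/-- **`#Sel^{163}(A(163)/ℚ) = 163`**, granted Buhler–Gross 1985 Ch. II on `A(163)` BY NAME and GZK, modulo the
binder `r_an(cm163) = 1`: the fact (with the KERNEL certificate `not_norm_bernoulliOnePrim_pow_121_le_p163` as its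
Bernoulli hypothesis and `exists_isTeichmullerCharacter`) gives rank `≤ 1`, `A(163)(ℚ)[163] = 0` and
(rank `≥ 1` ⇒) `Ш(A(163)/ℚ)[163] = 0`; GZK at `r_an = 1` gives rank `= 1`; then §1. CONDITIONAL on the two named
facts and the binder. [cite: BuhlerGross1985, Ch. II Prop. (7.2)(2), (8.3)(1) and Cor. (9.1) proof (pp. 16–18)]
[cite: GrossLMS1991, §2 (2.2)] -/
theorem natCard_selmerGroup_cm163 [Fact (Nat.Prime 163)]
    (hBG : BuhlerGross1985.firstDescent_grossCurve_threeModEight_of_bernoulli)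
    (hGZK : rank_eq_analyticRank_of_analyticRank_le_one) (hr : cm163.analyticRank = 1) :
    Nat.card (cm163.selmerGroup (163 : ℕ)) = 163 := by
  obtain ⟨ω, hω⟩ := exists_isTeichmullerCharacter (p := 163)
  obtain ⟨hle, htor, hsha⟩ := hBG 163 121 cm163 (Or.inr (Or.inr (Or.inr (Or.inr ⟨rfl, rfl, rfl⟩)))) ω hω
    (not_norm_bernoulliOnePrim_pow_121_le_p163 ω hω) cm163 ⟨1, one_smul _ _⟩
  have hrank : cm163.mordellWeilRank = 1 := by rw [(hGZK cm163 (by rw [hr])).1, hr]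
  refine natCard_selmerGroup_eq_of_rank_one cm163 (by norm_num) hrank ?_ ?_
  · intro c hc
    exact Subtype.ext (hsha (by rw [hrank]) c c.2 (by exact_mod_cast congrArg Subtype.val hc))
  · -- the fact's `A(163)(ℚ)[163] = 0` is stated with `ℚ`'s decidable equality on the Mordell–Weil group,
    -- the generic lemma with the classical one: transport along the equality of the two group structures
    exact torsionBy_eq_bot_of_forall_nsmul _ _ (by congr 1; exact Subsingleton.elim _ _) 163 htor

/-- **The `(163, −262537412640768000)` anchor**, granted Buhler–Gross 1985 Ch. II on `A(163)` BY NAME, GZK,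
Cassels and entire continuation, modulo TWO displayed data: `r_an(cm163) = 1` and `#Ш_an(cm163) = q ∈ ℚ` with
`ord_{163} q = 0` (the place of Kriz–Li Thm. 1.20 at `p = 163`; NOT certified here). Chain:
`natCard_selmerGroup_cm163` ⟹ `#Sel^{163} ∣ 163` ⟹ `rubinFormulaAtZp_of_unit_member`.
[cite: BuhlerGross1985, Ch. II (pp. 14–18)] [cite: Miller2011LMS, Def. 1.1] [cite: Cassels1965ArithmeticVIII] -/
theorem anchor_onesixtythree_of_buhlerGross [Fact (Nat.Prime 163)]
    (hBG : BuhlerGross1985.firstDescent_grossCurve_threeModEight_of_bernoulli)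
    (hCassels : bsdRHS_eq_of_isIsogenous) (hmod : hasEntireLFunction_rat)
    (hGZK : rank_eq_analyticRank_of_analyticRank_le_one) (hr : cm163.analyticRank = 1)
    {q : ℚ} (hq : shaAn cm163 = (q : ℂ)) (hv : padicValRat 163 q = 0) :
    ∃ (W₀ : WeierstrassCurve ℚ) (_ : W₀.IsElliptic) (_ : W₀.IsGloballyMinimal),
      W₀.j = -262537412640768000 ∧ W₀.analyticRank = 1 ∧ RamifiedCMRubinFormulaAtZp W₀ 163 := by
  haveI := P2.OddHeegnerTwists.isGloballyMinimal_cm163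
  have hdvd : Nat.card (cm163.selmerGroup ((163 : ℕ) : ℤ)) ∣ 163 := by
    rw [natCard_selmerGroup_cm163 hBG hGZK hr]
  exact ⟨cm163, inferInstance, P2.OddHeegnerTwists.isGloballyMinimal_cm163, j_cm163, hr,
    rubinFormulaAtZp_of_unit_member hCassels hmod hGZK
      (hasCM_of_j_eq cm163 (Or.inr (Or.inr (Or.inr (Or.inr (Or.inr (Or.inr rfl)))))) j_cm163)
      (cmRamified_of_j_eq cm163 (Or.inr (Or.inr (Or.inr (Or.inr (Or.inr ⟨rfl, rfl⟩))))) j_cm163) hr hq hv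
      hdvd⟩

/-! ## §3 The whole stub: six named facts + displayed per-curve data + the two `p = 7` anchors -/

/-- **`stub_unitAnchor` — the complete price list, kernel-checked.** The registered stub of line
`relative-anchor-transfer` holds VERBATIM granted: the six named facts (the printed `N < 5000` theorem in its two
`p`-parts, Cassels, entire continuation, GZK, Buhler–Gross 1985 Ch. II on `A(p)`); the analytic binders
`r_an(cmP) = 1` for `P = 11, 19, 43, 67, 163`; ONE analytic datum `ord_{163} #Ш_an(cm163) = 0` (not certified);
and the two displayed `p = 7` anchors (booked at Route U's price in `…AnchorSeven`). Nothing else.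
[cite: CreutzMiller2012, Thm. 1.1] [cite: MillerStoll2012, Thm. 9.1] [cite: BuhlerGross1985, Ch. II]
[cite: Miller2011LMS, Def. 1.1] [cite: Cassels1965ArithmeticVIII] -/
theorem stub_unitAnchor_of_print_of_data
    (hirr : bsdp_of_irreducible_of_conductor_lt) (hred : bsdp_of_reducible_of_conductor_lt)
    (hCassels : bsdRHS_eq_of_isIsogenous) (hmod : hasEntireLFunction_rat)
    (hGZK : rank_eq_analyticRank_of_analyticRank_le_one)
    (hBG : BuhlerGross1985.firstDescent_grossCurve_threeModEight_of_bernoulli)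
    (hr11 : cm11.analyticRank = 1) (hr19 : cm19.analyticRank = 1) (hr43 : cm43.analyticRank = 1)
    (hr67 : cm67.analyticRank = 1) (hr163 : cm163.analyticRank = 1)
    (hA163 : ∃ q : ℚ, shaAn cm163 = (q : ℂ) ∧ padicValRat 163 q = 0)
    (h7a : ∀ [Fact (Nat.Prime 7)], ∃ (W₀ : WeierstrassCurve ℚ) (_ : W₀.IsElliptic) (_ : W₀.IsGloballyMinimal),
      W₀.j = -3375 ∧ W₀.analyticRank = 1 ∧ RamifiedCMRubinFormulaAtZp W₀ 7)
    (h7b : ∀ [Fact (Nat.Prime 7)], ∃ (W₀ : WeierstrassCurve ℚ) (_ : W₀.IsElliptic) (_ : W₀.IsGloballyMinimal),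
      W₀.j = 16581375 ∧ W₀.analyticRank = 1 ∧ RamifiedCMRubinFormulaAtZp W₀ 7) :
    ∀ (W : WeierstrassCurve ℚ) [W.IsElliptic] [W.IsGloballyMinimal] (p : ℕ) [Fact p.Prime],
      W.HasCM → CMRamified W p → 5 ≤ p → W.analyticRank = 1 →
      ∃ (W₀ : WeierstrassCurve ℚ) (_ : W₀.IsElliptic) (_ : W₀.IsGloballyMinimal),
        W₀.HasCM ∧ CMRamified W₀ p ∧ W₀.analyticRank = 1 ∧ W₀.j = W.j ∧ RamifiedCMRubinFormulaAtZp W₀ p :=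
  stub_unitAnchor_of_conductor_lt_of_anchors_seven_onesixtythree hirr hred hCassels hmod hGZK hr11 hr19 hr43
    hr67 h7a h7b fun {_} => by
      obtain ⟨q, hq, hv⟩ := hA163
      exact anchor_onesixtythree_of_buhlerGross hBG hCassels hmod hGZK hr163 hq hv

end Summit.BirchSwinnertonDyer.BirchSwinnertonDyer.Theorems.PrintCFram.AnchorReduction

end
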